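import Summits.NavierStokesRegularity.NavierStokesRegularity.Theses.AxisymmetricExtremality
import Summits.NavierStokesRegularity.NavierStokesRegularity.Theorems.AxisymmetricExtremalityPFoldToAxisymmetric
import Summits.NavierStokesRegularity.NavierStokesRegularity.Theorems.AxisymmetricExtremalityMinimalDatumPFoldBranchOfAxisymMinimalDatum
import Literature.Analysis.FluidPDE.AxisymmetricEuler

/-!
# Strategist census s15-g3 — typed exhibits for crux `AxisymmetricKatoGlobal` (stmt-NavierStokesRegularity-15453)

Scratch file of the independent strategy census (family `s`, generation 3). Nothing here is a
route item; every theorem is sorry-free logic over tree declarations. Exhibits: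

* `NoAxisymMinimalDatum` (W₀) — the WEAKEST intermediate the route's deciding theorem admits in
  place of the crux: `closes_of_noAxisymMinimalDatum` re-proves `closes` from it, and
  `noAxisymMinimalDatum_of_crux` shows the crux implies it (so W₀ is formally weaker).
* `NoAxisymSubthresholdConcentration` (W₀⁻) — the regularity-side reading of W₀ forced by the
  landed dominance converse `Theorems.stub_branchOfAxisymMinimalDatum`: W₀ follows from
  "sub-threshold axisymmetric Kato solutions do not concentrate" (`noAxisymMinimalDatum_of_noConcentration`).
* the swirl split `SmallSwirlGlobal ε ∧ SwirlEvacuation ε → crux` (`crux_of_swirlSplit`), assembly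
  pure logic; both pieces open (see the census text for why neither is leverage).
-/

set_option linter.dupNamespace false

namespace Summit.NavierStokesRegularity.NavierStokesRegularity.Cruxes.AxisymmetricKatoGlobal.StrategistS15g3

open Summit.NavierStokesRegularity.NavierStokesRegularity.Theses.AxisymmetricExtremality
open Literature.Analysis.FluidPDE Literature.Analysis.FunctionSpaces MeasureTheory Set Function Filter

/-- The axisymmetry clause of the crux, verbatim (`= IsAxisymmetric u₀` unfolded, `Iff.rfl`). -/
def RotEquivariant (u₀ : EuclideanSpace ℝ (Fin 3) → EuclideanSpace ℝ (Fin 3)) : Prop :=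
  ∀ (θ : ℝ) (x : EuclideanSpace ℝ (Fin 3)), u₀ (WithLp.toLp 2 ![Real.cos θ * x 0 - Real.sin θ * x 1, Real.sin θ * x 0 + Real.cos θ * x 1, x 2]) = WithLp.toLp 2 ![Real.cos θ * u₀ x 0 - Real.sin θ * u₀ x 1, Real.sin θ * u₀ x 0 + Real.cos θ * u₀ x 1, u₀ x 2]

theorem rotEquivariant_iff_isAxisymmetric (u₀ : EuclideanSpace ℝ (Fin 3) → EuclideanSpace ℝ (Fin 3)) :
    RotEquivariant u₀ ↔ IsAxisymmetric u₀ := Iff.rfl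

/-! ## 1. The weakest intermediate `closes` admits: W₀ = no axisymmetric minimal blow-up datum -/

/-- **W₀.** For every `ν > 0` there is no Rusin–Šverák `Ḣ^{1/2}`-minimal blow-up datum
(`IsMinimalBlowupDatum ν u₀ g`: `u₀ ∈ L³` represented by `g`, weakly divergence-free,
`‖g‖ = ρ_max^pure(ν)`, no global Kato solution) which is axisymmetric about the `x₂`-axis. -/
def NoAxisymMinimalDatum : Prop :=
  ∀ ν : ℝ, 0 < ν → ∀ (u₀ : EuclideanSpace ℝ (Fin 3) → EuclideanSpace ℝ (Fin 3))
    (g : HomSobolev (EuclideanSpace ℝ (Fin 3)) (EuclideanSpace ℂ (Fin 3)) (1 / 2 : ℝ)),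
    IsMinimalBlowupDatum ν u₀ g → RotEquivariant u₀ → False

/-- The crux implies W₀ (W₀ is the threshold instance of the crux). -/
theorem noAxisymMinimalDatum_of_crux (h : AxisymmetricKatoGlobal) : NoAxisymMinimalDatum := by
  intro ν hν u₀ g hmin hax
  obtain ⟨hL3, hrep, hdiv, -, hnot⟩ := hmin
  exact hnot (h ν hν u₀ g hL3 hrep hdiv hax)

/-- `closes` re-proved with W₀ in place of the crux: the deciding theorem consumes the crux ONLY
at an axisymmetric minimal blow-up datum. -/
theorem closes_of_noAxisymMinimalDatum (h₂ : MinimalDatumPFold) (h₄ : PFoldToAxisymmetric)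
    (hW : NoAxisymMinimalDatum) : NavierStokesRegularity := by
  show Literature.NS.NavierStokesExistenceSmoothR3
  intro ν hν u₀ hsm hdiv hdec
  by_contra hno
  obtain ⟨u₁, g, hmin, hax⟩ := h₄ ν hν (h₂ ν hν ⟨u₀, hsm, hdiv, hdec, hno⟩)
  exact hW ν hν u₁ g hmin hax

/-- Same, with the PROVED crux `PFoldToAxisymmetric` discharged by its tree theorem: the summit
follows from `MinimalDatumPFold` and W₀ alone. -/
theorem closes_of_noAxisymMinimalDatum' (h₂ : MinimalDatumPFold) (hW : NoAxisymMinimalDatum) :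
    NavierStokesRegularity :=
  closes_of_noAxisymMinimalDatum h₂
    Summit.NavierStokesRegularity.NavierStokesRegularity.Theorems.axisymmetricExtremality_pFoldToAxisymmetric_proof hW

/-! ## 2. The regularity-side reading of W₀: non-concentration of sub-threshold axisymmetric solutions -/

/-- **W₀⁻ (non-concentration).** For `ν > 0` there is NO sequence of axisymmetric critical data
`U k` with classes `‖G k‖ < ρ_max^pure(ν)` (hence globally Kato-regular) whose Kato solutions
`u k` on `[0, 1)` concentrate at points `(1, x k)` (essential suprema on every backward parabolic
cylinder `Q_r(1, x k)` tending to `∞`). -/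
def NoAxisymSubthresholdConcentration : Prop :=
  ∀ ν : ℝ, 0 < ν → ∀ (U : ℕ → EuclideanSpace ℝ (Fin 3) → EuclideanSpace ℝ (Fin 3))
    (G : ℕ → HomSobolev (EuclideanSpace ℝ (Fin 3)) (EuclideanSpace ℂ (Fin 3)) (1 / 2 : ℝ))
    (u : ℕ → ℝ → EuclideanSpace ℝ (Fin 3) → EuclideanSpace ℝ (Fin 3)) (x : ℕ → EuclideanSpace ℝ (Fin 3)),
    (∀ k, MemLp (U k) 3 (volume : Measure (EuclideanSpace ℝ (Fin 3))) ∧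
      (G k).Represents (Literature.Analysis.FunctionSpaces.EuclideanSpace.complexify ∘ U k) ∧
      IsWeaklyDivFree (U k) ∧ ‖G k‖ₑ < rusinSverakRhoMaxPure ν) →
    (∀ k, IsMildNSSolutionOn (Set.Ico 0 1) ν 0 (U k) (u k) ∧ ContinuousInLpOn (Set.Ico 0 1) 3 (u k) ∧
      u k 0 = U k ∧ AEStronglyMeasurable (Function.uncurry (u k))
        (volume.restrict (Set.Ioo (0 : ℝ) 1 ×ˢ (Set.univ : Set (EuclideanSpace ℝ (Fin 3)))))) →
    (∀ k, RotEquivariant (U k)) →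
    ¬ (∀ r : ℝ, 0 < r → Filter.Tendsto (fun k => eLpNorm (Function.uncurry (u k)) ⊤
        (volume.restrict (parabolicCylinder r ((1 : ℝ), x k)))) Filter.atTop (nhds ⊤))

/-- W₀⁻ ⇒ W₀, by the landed dominance converse `stub_branchOfAxisymMinimalDatum`
(an axisymmetric minimal datum produces a concentrating axisymmetric sub-threshold sequence —
in fact the solutions of `c_k u₀`, `c_k ↑ 1`). -/
theorem noAxisymMinimalDatum_of_noConcentration (hC : NoAxisymSubthresholdConcentration) :
    NoAxisymMinimalDatum := by
  intro ν hν u₀ g hmin hax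
  obtain ⟨U, G, u, x, hdata, hkato, hconc, hrot⟩ :=
    Summit.NavierStokesRegularity.NavierStokesRegularity.Theorems.stub_branchOfAxisymMinimalDatum
      ν hν ⟨u₀, g, hmin, hax⟩
  exact hC ν hν U G u x hdata hkato hrot hconc

/-! ## 3. The swirl split: small-swirl global regularity ∧ swirl evacuation -/

/-- **S_ε (small-swirl global regularity, ABSOLUTE threshold).** Axisymmetric critical data whose
swirl `Γ = x₀u₁ − x₁u₀ = r u_θ` satisfies `|Γ| ≤ ε ν` everywhere have a global Kato solution.
(Known only with RELATIVE smallness — Chen–Lei, Liu–Zhang arXiv:1702.06279 (5.6)/(5.19) — or as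
an a-priori criterion on the solution — Lei–Zhang 2017, Wei 2016.) -/
def SmallSwirlGlobal (ε : ℝ) : Prop :=
  ∀ ν : ℝ, 0 < ν → ∀ (u₀ : EuclideanSpace ℝ (Fin 3) → EuclideanSpace ℝ (Fin 3))
    (g : HomSobolev (EuclideanSpace ℝ (Fin 3)) (EuclideanSpace ℂ (Fin 3)) (1 / 2 : ℝ)),
    MemLp u₀ 3 (volume : Measure (EuclideanSpace ℝ (Fin 3))) →
    g.Represents (Literature.Analysis.FunctionSpaces.EuclideanSpace.complexify ∘ u₀) →
    IsWeaklyDivFree u₀ → RotEquivariant u₀ → (∀ x, |swirl u₀ x| ≤ ε * ν) →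
    HasGlobalKatoSolution ν u₀

/-- **E_ε (swirl evacuation before blow-up).** If an axisymmetric critical datum has NO global
Kato solution, then some later slice of its evolution is again an axisymmetric critical datum
without global Kato solution but with swirl `|Γ| ≤ ε ν` everywhere (phrased datum-to-datum so
that the Kato restart/uniqueness bookkeeping stays inside the piece). -/
def SwirlEvacuation (ε : ℝ) : Prop :=
  ∀ ν : ℝ, 0 < ν → ∀ (u₀ : EuclideanSpace ℝ (Fin 3) → EuclideanSpace ℝ (Fin 3))
    (g : HomSobolev (EuclideanSpace ℝ (Fin 3)) (EuclideanSpace ℂ (Fin 3)) (1 / 2 : ℝ)),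
    MemLp u₀ 3 (volume : Measure (EuclideanSpace ℝ (Fin 3))) →
    g.Represents (Literature.Analysis.FunctionSpaces.EuclideanSpace.complexify ∘ u₀) →
    IsWeaklyDivFree u₀ → RotEquivariant u₀ → ¬ HasGlobalKatoSolution ν u₀ →
    ∃ (u₁ : EuclideanSpace ℝ (Fin 3) → EuclideanSpace ℝ (Fin 3))
      (g₁ : HomSobolev (EuclideanSpace ℝ (Fin 3)) (EuclideanSpace ℂ (Fin 3)) (1 / 2 : ℝ)),
      MemLp u₁ 3 (volume : Measure (EuclideanSpace ℝ (Fin 3))) ∧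
      g₁.Represents (Literature.Analysis.FunctionSpaces.EuclideanSpace.complexify ∘ u₁) ∧
      IsWeaklyDivFree u₁ ∧ RotEquivariant u₁ ∧ (∀ x, |swirl u₁ x| ≤ ε * ν) ∧
      ¬ HasGlobalKatoSolution ν u₁

/-- Assembly of the swirl split (pure logic): for any `ε`, `S_ε ∧ E_ε ⇒ crux`. -/
theorem crux_of_swirlSplit (ε : ℝ) (hS : SmallSwirlGlobal ε) (hE : SwirlEvacuation ε) :
    AxisymmetricKatoGlobal := by
  intro ν hν u₀ g hL3 hrep hdiv hax
  by_contra hno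
  obtain ⟨u₁, g₁, hL3₁, hrep₁, hdiv₁, hax₁, hsmall, hno₁⟩ := hE ν hν u₀ g hL3 hrep hdiv hax hno
  exact hno₁ (hS ν hν u₁ g₁ hL3₁ hrep₁ hdiv₁ hax₁ hsmall)

/-- Sanity: the swirl-free stratum `ε = 0` of S_ε is contained in the landed no-swirl stratum
theorem's hypothesis (`HasNoSwirl`), i.e. `S_0` asks nothing beyond `|Γ| ≤ 0 ⇒ Γ = 0`. -/
theorem hasNoSwirl_of_abs_swirl_le_zero {u₀ : EuclideanSpace ℝ (Fin 3) → EuclideanSpace ℝ (Fin 3)}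
    (h : ∀ x, |swirl u₀ x| ≤ 0 * (1 : ℝ)) : HasNoSwirl u₀ := by
  intro x
  have := h x
  rw [zero_mul] at this
  exact abs_nonpos_iff.1 this

end Summit.NavierStokesRegularity.NavierStokesRegularity.Cruxes.AxisymmetricKatoGlobal.StrategistS15g3
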